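import Summits.Ventures.Crystal3D.StickySpheres.D3Pieces

/-!
# Peeling lemma for `D₃` pieces (helper for the crux `WulffUpperBound`, stmt-Ventures-19147, line `WulffPeel`)

HONEST FRAMING. Part of the venture `Summits/Ventures/Crystal3D`. Pure `ℤ³` combinatorics on the
direction counts `shiftCount` of `StickySpheres/D3Pieces.lean`; nothing is said about packings or
ground states, and rung F-C1 is not moved.

For a finite `S ⊂ ℤ³` write `D(S) := 12·|S| − ∑_{δ ∈ d3Offsets} shiftCount S δ` (twice the lattice
deficiency `6|S| − #bonds`, a bond being a pair of points differing by one of the twelve minimal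
vectors `δ` of `D₃`). The theorem `stub_peel` says that every finite `S` contains, for every
`m ≤ |S|`, a subset `T` with `|T| = m` and `D(T) ≤ D(S)`.

Proof (generic top-peeling). Remove from `S` a point `q` maximising the height
`v ↦ v₀ + 10·v₁ + 100·v₂`. No minimal vector has height `0`, exactly six have negative height and
six have positive height; so at most six `δ` have `q + δ ∈ S` and at most six have `q − δ ∈ S`
(`card_filter_add_mem_le_six`, `card_filter_sub_mem_le_six`). Erasing `q` loses, in direction `δ`,
at most the two bonds `(q, q + δ)` and `(q − δ, q)` (`shiftCount_le_shiftCount_erase_add`), hence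
`∑_δ shiftCount S δ ≤ ∑_δ shiftCount (S.erase q) δ + 12` (`sum_shiftCount_le_sum_erase_add`), i.e.
`D(S.erase q) ≤ D(S)` (`exists_mem_erase_le`). Iterate (`exists_subset_card_eq_le`).
-/

noncomputable section

namespace Summit.Ventures.Crystal3D.Theorems

open Summit.Ventures.Crystal3D Finset
open scoped BigOperators

/-- Exactly six of the twelve minimal vectors of `D₃` have negative height `δ₀ + 10·δ₁ + 100·δ₂`. -/
theorem card_filter_d3Offsets_height_neg :
    (d3Offsets.filter fun δ : Fin 3 → ℤ => δ 0 + 10 * δ 1 + 100 * δ 2 < 0).card = 6 := by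
  decide

/-- Exactly six of the twelve minimal vectors of `D₃` have positive height `δ₀ + 10·δ₁ + 100·δ₂`. -/
theorem card_filter_d3Offsets_height_pos :
    (d3Offsets.filter fun δ : Fin 3 → ℤ => 0 < δ 0 + 10 * δ 1 + 100 * δ 2).card = 6 := by
  decide

/-- No minimal vector of `D₃` has height `0`. -/
theorem d3Offsets_height_ne_zero : ∀ δ ∈ d3Offsets, δ 0 + 10 * δ 1 + 100 * δ 2 ≠ 0 := by
  decide

/-- If `q` has maximal height on `S`, then `q + δ ∈ S` for at most six minimal vectors `δ`
(only those of negative height). -/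
theorem card_filter_add_mem_le_six {S : Finset (Fin 3 → ℤ)} {q : Fin 3 → ℤ}
    (hmax : ∀ v ∈ S, v 0 + 10 * v 1 + 100 * v 2 ≤ q 0 + 10 * q 1 + 100 * q 2) :
    (d3Offsets.filter fun δ => q + δ ∈ S).card ≤ 6 := by
  refine (card_le_card fun δ hδ => ?_).trans card_filter_d3Offsets_height_neg.le
  rw [mem_filter] at hδ ⊢
  refine ⟨hδ.1, ?_⟩
  have h1 := hmax _ hδ.2
  have h2 := d3Offsets_height_ne_zero δ hδ.1
  simp only [Pi.add_apply] at h1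
  omega

/-- If `q` has maximal height on `S`, then `q - δ ∈ S` for at most six minimal vectors `δ`
(only those of positive height). -/
theorem card_filter_sub_mem_le_six {S : Finset (Fin 3 → ℤ)} {q : Fin 3 → ℤ}
    (hmax : ∀ v ∈ S, v 0 + 10 * v 1 + 100 * v 2 ≤ q 0 + 10 * q 1 + 100 * q 2) :
    (d3Offsets.filter fun δ => q - δ ∈ S).card ≤ 6 := by
  refine (card_le_card fun δ hδ => ?_).trans card_filter_d3Offsets_height_pos.le
  rw [mem_filter] at hδ ⊢
  refine ⟨hδ.1, ?_⟩
  have h1 := hmax _ hδ.2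
  have h2 := d3Offsets_height_ne_zero δ hδ.1
  simp only [Pi.sub_apply] at h1
  omega

/-- Erasing a point `q` loses, in direction `δ`, at most the two lattice contacts `(q, q + δ)` and
`(q - δ, q)`: `#{v ∈ S : v + δ ∈ S} ≤ #{v ∈ S∖q : v + δ ∈ S∖q} + [q + δ ∈ S] + [q - δ ∈ S]`. -/
theorem shiftCount_le_shiftCount_erase_add (S : Finset (Fin 3 → ℤ)) (q δ : Fin 3 → ℤ) :
    shiftCount S δ ≤ shiftCount (S.erase q) δ +
      ((if q + δ ∈ S then 1 else 0) + (if q - δ ∈ S then 1 else 0)) := by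
  have hq : (({q} : Finset (Fin 3 → ℤ)).filter fun a => a + δ ∈ S).card =
      if q + δ ∈ S then 1 else 0 := by
    rw [card_filter, sum_singleton]
  have hqδ : (({q - δ} : Finset (Fin 3 → ℤ)).filter fun a => a ∈ S).card =
      if q - δ ∈ S then 1 else 0 := by
    rw [card_filter, sum_singleton]
  rw [← hq, ← hqδ]
  unfold shiftCount
  calc (S.filter fun a => a + δ ∈ S).card
      ≤ (((S.erase q).filter fun a => a + δ ∈ S.erase q) ∪
          ((({q} : Finset (Fin 3 → ℤ)).filter fun a => a + δ ∈ S) ∪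
            (({q - δ} : Finset (Fin 3 → ℤ)).filter fun a => a ∈ S))).card :=
        card_le_card fun a ha => by
          rw [mem_filter] at ha
          obtain ⟨haS, haδ⟩ := ha
          rw [mem_union, mem_union]
          by_cases h1 : a = q
          · subst h1
            exact Or.inr (Or.inl (mem_filter.2 ⟨mem_singleton_self _, haδ⟩))
          by_cases h2 : a + δ = q
          · refine Or.inr (Or.inr (mem_filter.2 ⟨?_, haS⟩))
            rw [mem_singleton, ← h2, add_sub_cancel_right]
          · exact Or.inl (mem_filter.2 ⟨mem_erase.2 ⟨h1, haS⟩, mem_erase.2 ⟨h2, haδ⟩⟩)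
    _ ≤ ((S.erase q).filter fun a => a + δ ∈ S.erase q).card +
          (((({q} : Finset (Fin 3 → ℤ)).filter fun a => a + δ ∈ S) ∪
            (({q - δ} : Finset (Fin 3 → ℤ)).filter fun a => a ∈ S))).card := card_union_le _ _
    _ ≤ _ := Nat.add_le_add_left (card_union_le _ _) _

/-- **One peeling step**: erasing a point `q` of maximal height loses at most twelve (ordered)
lattice contacts, `∑_δ shiftCount S δ ≤ ∑_δ shiftCount (S.erase q) δ + 12`. -/
theorem sum_shiftCount_le_sum_erase_add {S : Finset (Fin 3 → ℤ)} {q : Fin 3 → ℤ}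
    (hmax : ∀ v ∈ S, v 0 + 10 * v 1 + 100 * v 2 ≤ q 0 + 10 * q 1 + 100 * q 2) :
    ∑ δ ∈ d3Offsets, shiftCount S δ ≤ ∑ δ ∈ d3Offsets, shiftCount (S.erase q) δ + 12 := by
  have h1 := card_filter_add_mem_le_six hmax
  have h2 := card_filter_sub_mem_le_six hmax
  calc ∑ δ ∈ d3Offsets, shiftCount S δ
      ≤ ∑ δ ∈ d3Offsets, (shiftCount (S.erase q) δ +
          ((if q + δ ∈ S then 1 else 0) + (if q - δ ∈ S then 1 else 0))) :=
        sum_le_sum fun δ _ => shiftCount_le_shiftCount_erase_add S q δ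
    _ = ∑ δ ∈ d3Offsets, shiftCount (S.erase q) δ +
          ((d3Offsets.filter fun δ => q + δ ∈ S).card +
            (d3Offsets.filter fun δ => q - δ ∈ S).card) := by
        rw [sum_add_distrib, sum_add_distrib, card_filter, card_filter]
    _ ≤ ∑ δ ∈ d3Offsets, shiftCount (S.erase q) δ + 12 := by omega

/-- **One peeling step, deficiency form**: a nonempty `S` has a point `q` (any point of maximal
height) with `12·|S∖q| − ∑_δ shiftCount (S∖q) δ ≤ 12·|S| − ∑_δ shiftCount S δ`. -/
theorem exists_mem_erase_le {S : Finset (Fin 3 → ℤ)} (hS : S.Nonempty) :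
    ∃ q ∈ S, 12 * ((S.erase q).card : ℤ) - ∑ δ ∈ d3Offsets, (shiftCount (S.erase q) δ : ℤ) ≤
      12 * (S.card : ℤ) - ∑ δ ∈ d3Offsets, (shiftCount S δ : ℤ) := by
  obtain ⟨q, hq, hmax⟩ :=
    exists_max_image S (fun v : Fin 3 → ℤ => v 0 + 10 * v 1 + 100 * v 2) hS
  refine ⟨q, hq, ?_⟩
  have h : ((∑ δ ∈ d3Offsets, shiftCount S δ : ℕ) : ℤ) ≤
      ((∑ δ ∈ d3Offsets, shiftCount (S.erase q) δ + 12 : ℕ) : ℤ) := by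
    exact_mod_cast sum_shiftCount_le_sum_erase_add hmax
  have hpos : 1 ≤ S.card := card_pos.2 ⟨q, hq⟩
  rw [card_erase_of_mem hq, Nat.cast_sub hpos]
  push_cast at h ⊢
  linarith

/-- **Iterated peeling**: a finite `S ⊂ ℤ³` with `|S| = m + k` contains a `T` with `|T| = m` and
`12·|T| − ∑_δ shiftCount T δ ≤ 12·|S| − ∑_δ shiftCount S δ`. -/
theorem exists_subset_card_eq_le (m : ℕ) :
    ∀ k : ℕ, ∀ S : Finset (Fin 3 → ℤ), S.card = m + k →
      ∃ T : Finset (Fin 3 → ℤ), T ⊆ S ∧ T.card = m ∧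
        12 * (T.card : ℤ) - ∑ δ ∈ d3Offsets, (shiftCount T δ : ℤ) ≤
          12 * (S.card : ℤ) - ∑ δ ∈ d3Offsets, (shiftCount S δ : ℤ) := by
  intro k
  induction k with
  | zero =>
    intro S hS
    exact ⟨S, Subset.rfl, by simpa using hS, le_rfl⟩
  | succ k ih =>
    intro S hS
    have hne : S.Nonempty := by
      rw [← card_pos]
      omega
    obtain ⟨q, hq, hle⟩ := exists_mem_erase_le hne
    have hcard : (S.erase q).card = m + k := by
      rw [card_erase_of_mem hq, hS]
      omega
    obtain ⟨T, hTS, hTm, hTle⟩ := ih (S.erase q) hcard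
    exact ⟨T, hTS.trans (erase_subset q S), hTm, hTle.trans hle⟩

/-- **The peeling lemma** (stub `stub_peel` of line `WulffPeel`, crux `WulffUpperBound`): every
finite `S ⊂ ℤ³` can be shrunk to any cardinality `m ≤ |S|` without raising twice the lattice
deficiency `12·|S| − ∑_{δ ∈ d3Offsets} #{v ∈ S : v + δ ∈ S}`. -/
theorem stub_peel :
    ∀ S : Finset (Fin 3 → ℤ), ∀ m : ℕ, m ≤ S.card →
      ∃ T : Finset (Fin 3 → ℤ), T ⊆ S ∧ T.card = m ∧
        12 * (T.card : ℤ) - ∑ δ ∈ d3Offsets, (shiftCount T δ : ℤ) ≤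
          12 * (S.card : ℤ) - ∑ δ ∈ d3Offsets, (shiftCount S δ : ℤ) := by
  intro S m hm
  exact exists_subset_card_eq_le m (S.card - m) S (by omega)

end Summit.Ventures.Crystal3D.Theorems

end
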